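import Summits.ABC.IUTFork.Repair.CandMochizuki32Uniform
import Summits.ABC.IUTFork.Repair.CandMochizuki32SplitB1
import Summits.ABC.IUTFork.Repair.CandMochizuki33
import Summits.ABC.IUTFork.Repair.CandMochizuki31
import Summits.ABC.IUTFork.Repair.CandMochizuki30
import Summits.ABC.IUTFork.Repair.CandMochizuki1
import Summits.ABC.IUTFork.Repair.CandMochizuki2
import Summits.ABC.IUTFork.Repair.CandMochizuki3
import Summits.ABC.IUTFork.Repair.CandMochizuki4
import Summits.ABC.IUTFork.Repair.CandMochizuki5
import Summits.ABC.IUTFork.Repair.CandMochizuki6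
import Summits.ABC.IUTFork.Repair.CandMochizuki7
import Summits.ABC.IUTFork.Repair.CandMochizuki40
import HarnessLib

/-!
# REPAIR branch B1 / CandMochizuki32UniformB1 — the P♮ᵤ COLUMN (uniform-scalar bed, `r = 1/4`) for the OTHER sub-cell B1 rows:
# M01a/b/c · M02a/b · M45 · M47a/b/c (m1) · M03a/b · M04a/b/c · M36a/b/c/d (m2) · M40 (m4) · X07a/b/c · M31 · M06 (m3)

PROOF-ONLY file (no definition, no `Prop` fact; class `Mochizuki`, sub-cell B1, seat abc-iut-rp-m3 gen 5; companion of `CandMochizuki32Uniform`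
(p451255: the bed's `SSFrame`, RP-M51 ✗ with (Lin) `r = 1/4`, RP-M32a/b/c ✗) in the shape of this seat's P♮₁ / SCAL columns (`CandMochizuki32SplitB1`
p439507, `CandMochizuki32Scal` p441491). TAKES NO SIDE between Mochizuki, Scholze–Stix, Joshi, Dupuy–Hilado or anyone; nothing here asserts abc or
[IUTchIII] Cor. 3.12 proved or refuted; candidates are hypotheses — typed ≠ proved, instantiated ≠ endorsed. Closed theorems about TOY MODEL DATA,
BY NAME on this seat's bed P♮ᵤ (`Cor312UniformExcursionBoxes` / `…Model` / `…Thm311` / `…Witness`, p450457–p451108: `uFull`, `uSetting`,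
`gradedRegionK KU`, `qDatumU`; volumes q `−1`/`−1`, own `−1`/`−4` (honest `j²`), hull `−1/4`/`−1`; Statement strict `−1 < −5/8`; `¬S`, `¬Licence`) and
on the landed candidate files `Repair.CandMochizuki1/2/3/4/5/6/7/30/31/33/40` (abc-iut-rp-m1 / rp-m2 / rp-m3 / rp-m4). Nothing restated; DEFS-FREEZE kept.

THE BED: abc-iut-w5-d230's split shells (two valuations over one place, TRIVIAL Ism, (Ind1) = all capsule permutations), rp-h3's graded excursion
geometry with cap `8`, ONE Tate datum `q = 2^{−2}` (q pilot point at both labels), Θ = honest pure pilot point `q⁴` at `j = 2` and the skew pilot point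
`u ⊗ (q·e_true)` at `j = 1`; the hull of the (Ind1)-orbit is ONE QUARTER of the own volume at BOTH labels.

CELLS (EVAL-LOG column «P♮ᵤ»; ✓ HOLDS / ✗ FAILS):
* m1 — **M01a ✓** (`M01a_u`: the Θ-pilot's own PN-volume `−5/2 < −1 = −|log q|` AND the typed Statement — the first honest bed of record where
  (LVEx)'s strict clause and the typed inequality hold TOGETHER) · **M01b ✓** ((ΘInd): `¬PilotKummerCompat`) · **M01c ✓** (`own = avgJsq·(−|log q|) =
  (5/2)·(−1)`: the (C11)–(C14) degree identity) · M02a ✓ · **M02b ✗** (the bed IS a «single hol. str.» in rp-m1's typed sense = RP-M31's honest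
  `N = 1` class, `M31_u_iff`) · **M45 ✓** (`−5/2 < −5/8`) · M47a ✗ / M47b ✗ / `IsmIsometric` ✓ / M47c ✗ (split shells: Ism trivial, the mover is the
  (Ind1) capsule swap, which fixes the unit box — as at P♮₁).
* m2 — M03a ✓ · **M03b ✗ / M04a ✗** (⟺ S) · **M04b ✗ · M36b ✗ for EVERY saturation** (both put `ρ qK` inside the hull: the Licence, false at `j = 2`) ·
  M04c ✓ (typed (IPL) ∧ (SHE)) · M36a ✓ (sat = id) · **M36c ✓** (READING 0 per packet: `−1 ≤ −1/4`, `−1 ≤ −1`) · **M36d ✓** (= Statement) · GapH3 ✗.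
* m4 — `Placewise` ✓ · M40a ✗ · M40b ✗ (one place).
* m3 — X07a ✓ · X07b ✓ · **X07c `AO4` ✗** (`gbox (lastDepth 2 2) ≠ gbox (lastDepth 2 8)`) · **M31 `H N ⟺ N = 1`** (HONEST scaling) · **M06 `H s ⟺
  ∀ j, (3/4)·j² ≤ s_j`** (inflation EXACTLY `3/4`, `3`: cap `0` ✗, cap `(3/4)j²` ✓ exactly).
Package `profile_uniform_B1`. READING (neutral): at the uniform-scalar bed every VOLUME-INEQUALITY row of B1 (M01a, M01c, M36c/d, M45) holds together
with honest `j²`-scaling (M31 `N = 1`) and the typed Statement, while every TRANSPORT / INCLUSION / IDENTIFICATION row (M03b, M04a/b, M36b, X07c, M32a/b/c)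
fails with `S` — the column separates «volume law» rows from «region transport» rows more sharply than any earlier bed (at P♮ₑ M01a already holds but
(Lin) fails; at P♮₁ S holds). No verdict word is proposed here. [claim: Mochizuki2012, status: disputed] for every IUT noun;
[cite: ScholzeStix2018, §2.2 pp. 9–10] for the frame side. bears_on: LADDER-ABC:A2.B (A2.RP)
-/

noncomputable section

open Set

namespace Summit.ABC.IUTFork.Repair.CandMochizuki32UniformB1

open Thm311 Cor312 Cor312Vol Cor312.IdentifiedNonVacuity Cor312Vol.NaiveWitness Cor312Vol.PinnedWitness Cor312Vol.SplitWitness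
  Cor312Vol.ExcursionWitness Cor312Vol.UniformWitness Repair.CandMochizuki32 Repair.CandMochizuki32Uniform Literature.IUT.LogThetaLattice

/-! ## 0. The bed's own procession-normalised Θ-volume and hull volume -/

/-- The Θ-pilot's OWN procession-normalised volume at P♮ᵤ is `−5/2` (the mean of `−1`, `−4`), for every `m`. [folklore] -/
theorem u_thetaPilotOwnVol (m : ℤ) : CandMochizuki1.thetaPilotOwnVol uFull.toLatticeSituation uSetting m = -5 / 2 := by
  have key : ∀ i : Fin splitIndex.lstar,
      uData.logvol (Setting.labelSucc i) (default : splitIndex.VQ) (uSetting.thetaRegion m (Setting.labelSucc i) default) =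
        -((((i : ℕ) + 1 : ℕ) : ℝ) ^ 2) := fun i => by
    have h := (uSetting_thetaVol m i default).1
    rw [uSetting_qLocal] at h
    exact h.trans (by ring)
  show (∑ i : Fin splitIndex.lstar, ∑ᶠ vQ : splitIndex.VQ,
      uData.logvol (Setting.labelSucc i) vQ (uSetting.thetaRegion m (Setting.labelSucc i) vQ)) / (splitIndex.lstar : ℝ) = -5 / 2
  simp only [finsum_unique, key, Fin.sum_univ_two]
  norm_num [splitIndex]

/-- «the average of the j²» on the split index is `5/2`. [folklore] -/
theorem avgJsq_split : CandMochizuki1.avgJsq splitIndex = 5 / 2 := by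
  unfold CandMochizuki1.avgJsq processionNormalized
  simp only [Fin.sum_univ_two]
  norm_num [splitIndex]

/-- The hull volume at label `j` is `−j²/4` (the real number under `uSetting_thetaLocal`). [folklore] -/
theorem u_hullVol (i : Fin splitIndex.lstar) (vQ : splitIndex.VQ) :
    (uFull.D uSetting.n).logvol _ vQ (uSetting.thetaHull (Setting.labelSucc i) vQ) = -((((i : ℕ) + 1 : ℕ) : ℝ) ^ 2) / 4 := by
  have h := uSetting_thetaLocal i vQ
  unfold Setting.thetaLocal at h
  rw [if_pos (uSetting_hullDefined _ vQ)] at h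
  exact_mod_cast h

/-! ## 1. rp-m1's rows (`CandMochizuki1/3/5/7`): M01a/b/c, M02a/b, M45, M47a/b/c -/

/-- **RP-M01a at P♮ᵤ: HOLDS** — the strict clause `own = −5/2 < −1 = −|log(q)|` for every `m` AND the typed Statement: the first honest bed of record
where both conjuncts hold together. [claim: Mochizuki2012, status: disputed] -/
theorem M01a_u : CandMochizuki1.H uFull.toLatticeSituation uSetting (gradedRegionK KU) qDatumU :=
  ⟨fun m => by rw [u_thetaPilotOwnVol, uSetting_negLogQ]; norm_num, uSetting_statement_strict.1⟩

/-- **RP-M01b at P♮ᵤ: HOLDS** ((ΘInd) as typed = `¬PilotKummerCompat`, which fails at the bed by the ∀-countermodel). [claim: Mochizuki2012, status: disputed] -/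
theorem M01b_u : CandMochizuki1.H' uFull.toLatticeSituation uSetting (gradedRegionK KU) qDatumU :=
  (CandMochizuki1.H'_iff_not_pilotKummerCompat _ _ _ _).2 uSetting_not_pilotKummerCompat

/-- **RP-M01c at P♮ᵤ: HOLDS** — the (C11)–(C14) degree identity `own = avgJsq · (−|log q|)`: `−5/2 = (5/2)·(−1)`. [claim: Mochizuki2012, status: disputed] -/
theorem M01c_u : CandMochizuki1.H'' uFull.toLatticeSituation uSetting (gradedRegionK KU) qDatumU := fun m => by
  rw [u_thetaPilotOwnVol, avgJsq_split, uSetting_negLogQ]; norm_num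

/-- **RP-M02a at P♮ᵤ: HOLDS** (admissible Θ-images ∧ Thm 3.11 (ii)(a)). [claim: Mochizuki2012, status: disputed] -/
theorem M02a_u : CandMochizuki3.H uFull.toLatticeSituation uSetting (gradedRegionK KU) qDatumU :=
  (CandMochizuki3.H_iff _ _ _ _).2 ⟨uSetting_thetaRegionsAdm, (u_partII uSetting.n).1⟩

/-- The (Ind3)-region read through the operator has the HONEST volume `j²·(q-volume)`. [folklore] -/
theorem u_rhoPsi_logvol (i : Fin splitIndex.lstar) (vQ : splitIndex.VQ) :
    (uFull.toLatticeSituation.D uSetting.n).logvol _ vQ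
        (gradedRegionK KU (uFull.toLatticeSituation.D uSetting.n).Ψ (Setting.labelSucc i) vQ) =
      (((i : ℕ) + 1 : ℕ) : ℝ) ^ 2 * uSetting.qLocal (Setting.labelSucc i) vQ := by
  rw [← thetaRegion3_eq_of_thetaPinned uFull.toLatticeSituation uSetting (gradedRegionK KU) u_honesty_vector.1 uSetting_thetaPinned]
  exact u_honesty_vector.2.2.2.2.2.2.1 i vQ

/-- **RP-M31 at P♮ᵤ: `H N ⟺ N = 1`** — the bed is HONESTLY `j²`-scaled (the `N = 1` class). [claim: Mochizuki2012, status: disputed] -/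
theorem M31_u_iff (N : ℕ) : CandMochizuki31.H uFull.toLatticeSituation uSetting (gradedRegionK KU) qDatumU N ↔ N = 1 := by
  constructor
  · intro h
    have h0 := h ⟨0, Nat.succ_pos 1⟩ ()
    rw [u_rhoPsi_logvol, uSetting_qLocal] at h0
    norm_num at h0
    exact_mod_cast h0.symm
  · rintro rfl
    exact (CandMochizuki31.H_one_iff _ _ _ _).2 fun i vQ => u_rhoPsi_logvol i vQ

/-- **RP-M02b at P♮ᵤ: FAILS** — the bed IS a «single hol. str.» in rp-m1's typed sense (`SingleHolStr` ⟺ RP-M31's `N = 1` class under the q-pin).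
[claim: Mochizuki2012, status: disputed] -/
theorem not_M02b_u : ¬ CandMochizuki3.H' uFull.toLatticeSituation uSetting (gradedRegionK KU) qDatumU := fun h =>
  h ((CandMochizuki3.singleHolStr_iff_scaled _ _ _ _ uSetting_qPinned).2 ((CandMochizuki31.H_one_iff _ _ _ _).1 ((M31_u_iff 1).2 rfl)))

/-- **RP-M45 at P♮ᵤ: HOLDS** — `−|log(Θ)| = −5/8` is finite and STRICTLY exceeds the Θ-pilot's own volume `−5/2`. [claim: Mochizuki2012, status: disputed] -/
theorem M45_u : CandMochizuki5.H uFull.toLatticeSituation uSetting (gradedRegionK KU) qDatumU :=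
  ⟨uSetting_statement_strict.1.1, fun m => by rw [u_thetaPilotOwnVol, uSetting_negLogTheta, WithTop.coe_lt_coe]; norm_num⟩

/-- **RP-M47a at P♮ᵤ: `FullIsm` FAILS** (the split signature: `−1` is an isometry of the shell but `Ism = {1}`; this seat's `not_M47a_split`, same shells).
[claim: Mochizuki2012, status: disputed] -/
theorem not_M47a_u : ¬ CandMochizuki7.H uFull.toLatticeSituation uSetting (gradedRegionK KU) qDatumU := CandMochizuki32SplitB1.not_M47a_split

/-- **RP-M47b at P♮ᵤ: FAILS** (its first conjunct is M47a). [claim: Mochizuki2012, status: disputed] -/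
theorem not_M47b_u : ¬ CandMochizuki7.H' uFull.toLatticeSituation uSetting (gradedRegionK KU) qDatumU := fun h => not_M47a_u h.1

/-- **RP-M47c at P♮ᵤ: `FullInd` FAILS** — the capsule swap `permFamily (moveLast 0)` maps the integral structure `gbox 0` onto itself but is no
(Ind2)-family: those act trivially on the split shells, while the swap moves the Θ-box out of itself (`uSetting_excursion`). [claim: Mochizuki2012, status: disputed] -/
theorem not_M47c_u : ¬ CandMochizuki7.H'' uFull.toLatticeSituation uSetting (gradedRegionK KU) qDatumU := by
  intro h
  have hpk : ∀ (j : splitIndex.Label) (vQ : splitIndex.VQ),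
      permFamily (moveLast 0) j vQ '' (uFull.toLatticeSituation.D uSetting.n).shellPk j vQ =
        (uFull.toLatticeSituation.D uSetting.n).shellPk j vQ := fun j vQ => by
    show permFamily (moveLast 0) j vQ '' gbox 0 = gbox 0
    exact image_gbox_zero ((moveFamily_memU 0).2 j vQ)
  have hid : ∀ (j : splitIndex.Label) (vQ : splitIndex.VQ) (x : splitShells.Packet j vQ), permFamily (moveLast 0) j vQ x = x :=
    fun j vQ x => CandMochizuki32SplitB1.apply_eq_self_of_mem_Ind2Family (h _ hpk) j vQ x
  obtain ⟨-, hex⟩ := uSetting_excursion ⟨0, Nat.succ_pos 1⟩ ()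
  refine hex ?_
  rintro _ ⟨x, hx, rfl⟩
  rw [hid, uSetting_thetaRegion, ← uSetting_thetaRegion3]
  exact hx

/-! ## 2. rp-m2's rows (`CandMochizuki2/4/6`): M03a/b, M04a/b/c, M36a/b/c/d -/

/-- (IPL) as typed holds for `uFull` (link data `naiveLink`). [folklore] -/
theorem uFull_ipl : uFull.link.IPL :=
  uFull.link.ipl_iff_nonempty.2 fun n m => ⟨uFull.link.kumDelta n m ≪≫ (uFull.link.kumDelta (n + 1) m).symm⟩

/-- **RP-M03a at P♮ᵤ: HOLDS** (the constant assignment). [claim: Mochizuki2012, status: disputed] -/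
theorem M03a_u : ∃ Out : CandMochizuki2.OutputAssignment uFull.toLatticeSituation uSetting,
    CandMochizuki2.H uFull.toLatticeSituation uSetting Out :=
  ⟨_, CandMochizuki2.H_const _ _⟩

/-- **RP-M03b at P♮ᵤ: FAILS** (`(∃ Out, H' Out) ⟺ S` under the pins, and `¬S`). [claim: Mochizuki2012, status: disputed] -/
theorem not_M03b_u : ¬ ∃ Out : CandMochizuki2.OutputAssignment uFull.toLatticeSituation uSetting,
    CandMochizuki2.H' uFull.toLatticeSituation uSetting (gradedRegionK KU) qDatumU Out := fun h =>
  uSetting_not_pilotKummerIndRelated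
    ((CandMochizuki2.exists_H'_iff_S _ _ _ _ u_honesty_vector.1 uSetting_pinnedRegions3).1 h)

/-- **RP-M04a at P♮ᵤ: FAILS** (`H ⟺ S` under the pins). [claim: Mochizuki2012, status: disputed] -/
theorem not_M04a_u : ¬ CandMochizuki4.H uFull.toLatticeSituation uSetting (gradedRegionK KU) qDatumU := fun h =>
  uSetting_not_pilotKummerIndRelated ((CandMochizuki4.H_iff_S_of_pinned3 _ _ _ _ u_honesty_vector.1 uSetting_pinnedRegions3).1 h)

/-- **RP-M04b at P♮ᵤ: FAILS** — under the link pin it puts `ρ qK` inside the hull at every label, i.e. the Licence (q-pin), false at `j = 2`.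
[claim: Mochizuki2012, status: disputed] -/
theorem not_M04b_u : ¬ CandMochizuki4.H' uFull.toLatticeSituation uSetting (gradedRegionK KU) qDatumU := fun h =>
  uSetting_not_licence fun i vQ => by
    rw [show uSetting.qRegion (Setting.labelSucc i) vQ = gradedRegionK KU qDatumU (Setting.labelSucc i) vQ from uSetting_qPinned _ vQ]
    exact h uSetting_pilotLink i vQ

/-- **RP-M04c at P♮ᵤ: HOLDS** (typed (IPL) ∧ (SHE) of `uFull`). [claim: Mochizuki2012, status: disputed] -/
theorem M04c_u : CandMochizuki4.H'' uFull := ⟨uFull_ipl, uFull.sheTyped_of_statement_of_ipl uFull_statement uFull_ipl⟩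

/-- **RP-M36a at P♮ᵤ (sat = id): HOLDS** (extensivity + monotonicity of the hull). [claim: Mochizuki2012, status: disputed] -/
theorem M36a_u : CandMochizuki6.H uFull.toLatticeSituation uSetting (fun _ _ U => U) :=
  ⟨fun _ _ _ => subset_rfl, fun _ vQ _ hU => (Set.subset_sUnion_of_mem hU).trans ((uSetting.frame _ vQ).subset_hull _)⟩

/-- **RP-M36b at P♮ᵤ: FAILS for EVERY saturation** — any `H'` puts `ρ qK` inside the hull at every label (`rho_subset_thetaHull_of_H'`), i.e. the
Licence, false at `j = 2`. [claim: Mochizuki2012, status: disputed] -/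
theorem not_M36b_u (sat : CandMochizuki6.Saturation uFull.toLatticeSituation) :
    ¬ CandMochizuki6.H' uFull.toLatticeSituation uSetting (gradedRegionK KU) qDatumU sat := fun h =>
  uSetting_not_licence fun i vQ => by
    rw [show uSetting.qRegion (Setting.labelSucc i) vQ = gradedRegionK KU qDatumU (Setting.labelSucc i) vQ from uSetting_qPinned _ vQ]
    exact CandMochizuki6.rho_subset_thetaHull_of_H' _ _ _ _ h i vQ

/-- **RP-M36c (READING 0) at P♮ᵤ: HOLDS** — per packet `qLocal = −1 ≤ −j²/4 = thetaLocal` (`−1/4`, `−1`; equality at `j = 2`).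
[claim: Mochizuki2012, status: disputed] -/
theorem M36c_u : CandMochizuki6.H'' uFull.toLatticeSituation uSetting := fun i vQ => by
  rw [uSetting_qLocal, uSetting_thetaLocal, WithTop.untopD_coe]
  fin_cases i <;> norm_num

/-- **RP-M36d at P♮ᵤ: HOLDS** (`H''' ⟺ Statement` under `ThetaFinite`). [claim: Mochizuki2012, status: disputed] -/
theorem M36d_u : CandMochizuki6.H''' uFull.toLatticeSituation uSetting :=
  (CandMochizuki6.H'''_iff_statement _ _ uSetting_thetaFinite).2 uSetting_statement_strict.1

/-! ## 3. rp-m4's rows (`CandMochizuki40`): one place -/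

/-- **`Placewise` HOLDS at P♮ᵤ** (one place: placewise = global). [claim: Mochizuki2012, status: disputed] -/
theorem placewise_u : CandMochizuki40.Placewise uSetting :=
  (CandMochizuki40.placewise_iff_statement_onePlace uSetting).2 uSetting_statement_strict.1

/-- **RP-M40a at P♮ᵤ: FAILS** (`H ⟺ ¬Statement` at one place). [claim: Mochizuki2012, status: disputed] -/
theorem not_M40a_u : ¬ CandMochizuki40.H uSetting := fun h =>
  (CandMochizuki40.H_iff_not_statement_onePlace uSetting).1 h uSetting_statement_strict.1

/-- **RP-M40b at P♮ᵤ: FAILS** (one-place collapse). [claim: Mochizuki2012, status: disputed] -/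
theorem not_M40b_u : ¬ CandMochizuki40.H' uSetting := CandMochizuki40.not_H'_onePlace uSetting

/-! ## 4. This seat's remaining rows: X07a/b/c, M06 -/

/-- **RP-X07a/b at P♮ᵤ: HOLD** (as at every setting). [claim: Mochizuki2012, status: disputed] -/
theorem X07ab_u : CandMochizuki33.AO1 uFull.toLatticeSituation uSetting (gradedRegionK KU) qDatumU ∧
    CandMochizuki33.AO2 uFull.toLatticeSituation uSetting (gradedRegionK KU) qDatumU :=
  ⟨CandMochizuki33.ao1_holds _ _ _ _, CandMochizuki33.ao2_holds _ _ _ _⟩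

/-- **RP-X07c `AO4` at P♮ᵤ: FAILS** — identification WITHOUT indeterminacy: at `j = 2` the q-box `gbox (lastDepth 2 2)` is no Kummer image
`gbox (lastDepth 2 8)` of the Θ-pilot (the witness `2^{−2}·e_{c≡true}`). [claim: Mochizuki2012, status: disputed] -/
theorem not_AO4_u : ¬ CandMochizuki33.AO4 uFull.toLatticeSituation uSetting (gradedRegionK KU) qDatumU := by
  intro h
  have hj := Setting.labelSucc_ne_zero (⟨1, Nat.lt_succ_self 1⟩ : Fin splitIndex.lstar)
  obtain ⟨m, hm⟩ := (CandMochizuki33.AO4_iff _ _ _ _).1 h (Setting.labelSucc (⟨1, Nat.lt_succ_self 1⟩ : Fin splitIndex.lstar)) ()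
  rw [(uSetting_regions_of_ne_zero hj ()).2, uSetting_thetaRegion, thetaGlueU_one_of_ne_zero hj] at hm
  have hw : ((2 : ℚ)⁻¹ ^ 2) • ePt _ () (fun _ => true) ∈
      (gbox (lastDepth (Setting.labelSucc (⟨1, Nat.lt_succ_self 1⟩ : Fin splitIndex.lstar)) 2) : Set (splitShells.Packet _ ())) :=
    (pow_smul_ePt_mem_gbox_lastDepth_iff () rfl 2 2).2 le_rfl
  rw [hm, smul_ePt_mem_gbox_iff, thetaProfile_top, hullTop_two] at hw
  norm_num at hw

/-- **RP-M06 at P♮ᵤ: `H s ⟺ ∀ j, (3/4)·j² ≤ s_j`** — [IUTchIV] Step (v)'s cap must cover the inflation hull − own = `−j²/4 + j² = (3/4)·j²`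
EXACTLY (`3/4` at `j = 1`, `3` at `j = 2`). [claim: Mochizuki2012, status: disputed] -/
theorem M06_u_iff (s : Fin splitIndex.lstar → splitIndex.VQ → ℝ) :
    CandMochizuki30.H uFull.toLatticeSituation uSetting (gradedRegionK KU) qDatumU s ↔
      ∀ (i : Fin splitIndex.lstar) (vQ : splitIndex.VQ), 3 / 4 * (((i : ℕ) + 1 : ℕ) : ℝ) ^ 2 ≤ s i vQ := by
  unfold CandMochizuki30.H
  refine forall₂_congr fun i vQ => ?_
  rw [show (uFull.toLatticeSituation.D uSetting.n).logvol _ vQ (uSetting.thetaHull (Setting.labelSucc i) vQ) =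
      -((((i : ℕ) + 1 : ℕ) : ℝ) ^ 2) / 4 from u_hullVol i vQ, (uSetting_thetaVol 0 i vQ).2, uSetting_qLocal]
  constructor <;> intro h <;> linarith

/-- The cap `0` (the (Ind)-trivial countermodel's inflation) is TOO SMALL at P♮ᵤ … [claim: Mochizuki2012, status: disputed] -/
theorem not_M06_zero_u : ¬ CandMochizuki30.H uFull.toLatticeSituation uSetting (gradedRegionK KU) qDatumU (fun _ _ => 0) := fun h => by
  have h0 := (M06_u_iff _).1 h ⟨0, Nat.succ_pos 1⟩ ()
  norm_num at h0

/-- … and the cap `(3/4)·j²` is met EXACTLY. [claim: Mochizuki2012, status: disputed] -/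
theorem M06_u_exact : CandMochizuki30.H uFull.toLatticeSituation uSetting (gradedRegionK KU) qDatumU
    (fun i _ => 3 / 4 * (((i : ℕ) + 1 : ℕ) : ℝ) ^ 2) :=
  (M06_u_iff _).2 fun _ _ => le_rfl

/-! ## 5. The package -/

/-- **THE P♮ᵤ COLUMN OF SUB-CELL B1 (other rows), packaged** (RP-M32a/b/c, RP-M51 and the bed's interface are `CandMochizuki32Uniform.profile_uSetting` /
`uniform_scalar_corner`): m1 M01a/b/c ✓, M02a ✓, M02b ✗, M45 ✓, M47a/b/c ✗ with `IsmIsometric` ✓; m2 M03a ✓, M03b ✗, M04a/b ✗, M04c ✓, M36a ✓ (id),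
M36b ✗ (id; every saturation: `not_M36b_u`), M36c/d ✓, GapH3 ✗; m4 Placewise ✓, M40a/b ✗; m3 X07a/b ✓, X07c ✗, M31 `H 1` ✓ / `H 2` ✗, M06 cap `0` ✗ /
cap `(3/4)j²` ✓. [claim: Mochizuki2012, status: disputed] -/
theorem profile_uniform_B1 :
    (CandMochizuki1.H uFull.toLatticeSituation uSetting (gradedRegionK KU) qDatumU ∧
      CandMochizuki1.H' uFull.toLatticeSituation uSetting (gradedRegionK KU) qDatumU ∧
      CandMochizuki1.H'' uFull.toLatticeSituation uSetting (gradedRegionK KU) qDatumU ∧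
      CandMochizuki3.H uFull.toLatticeSituation uSetting (gradedRegionK KU) qDatumU ∧
      ¬ CandMochizuki3.H' uFull.toLatticeSituation uSetting (gradedRegionK KU) qDatumU ∧
      CandMochizuki5.H uFull.toLatticeSituation uSetting (gradedRegionK KU) qDatumU ∧
      ¬ CandMochizuki7.H uFull.toLatticeSituation uSetting (gradedRegionK KU) qDatumU ∧ ¬ CandMochizuki7.H' uFull.toLatticeSituation uSetting (gradedRegionK KU) qDatumU ∧
      CandMochizuki7.IsmIsometric splitShells ∧ ¬ CandMochizuki7.H'' uFull.toLatticeSituation uSetting (gradedRegionK KU) qDatumU) ∧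
    ((∃ Out : CandMochizuki2.OutputAssignment uFull.toLatticeSituation uSetting, CandMochizuki2.H uFull.toLatticeSituation uSetting Out) ∧
      (¬ ∃ Out : CandMochizuki2.OutputAssignment uFull.toLatticeSituation uSetting,
        CandMochizuki2.H' uFull.toLatticeSituation uSetting (gradedRegionK KU) qDatumU Out) ∧
      ¬ CandMochizuki4.H uFull.toLatticeSituation uSetting (gradedRegionK KU) qDatumU ∧
      ¬ CandMochizuki4.H' uFull.toLatticeSituation uSetting (gradedRegionK KU) qDatumU ∧ CandMochizuki4.H'' uFull ∧
      CandMochizuki6.H uFull.toLatticeSituation uSetting (fun _ _ U => U) ∧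
      ¬ CandMochizuki6.H' uFull.toLatticeSituation uSetting (gradedRegionK KU) qDatumU (fun _ _ U => U) ∧
      CandMochizuki6.H'' uFull.toLatticeSituation uSetting ∧ CandMochizuki6.H''' uFull.toLatticeSituation uSetting ∧
      ¬ GapH3 uFull.toLatticeSituation uSetting (gradedRegionK KU) qDatumU) ∧
    (CandMochizuki40.Placewise uSetting ∧ ¬ CandMochizuki40.H uSetting ∧ ¬ CandMochizuki40.H' uSetting) ∧
    (CandMochizuki33.AO1 uFull.toLatticeSituation uSetting (gradedRegionK KU) qDatumU ∧
      CandMochizuki33.AO2 uFull.toLatticeSituation uSetting (gradedRegionK KU) qDatumU ∧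
      ¬ CandMochizuki33.AO4 uFull.toLatticeSituation uSetting (gradedRegionK KU) qDatumU ∧
      CandMochizuki31.H uFull.toLatticeSituation uSetting (gradedRegionK KU) qDatumU 1 ∧
      ¬ CandMochizuki31.H uFull.toLatticeSituation uSetting (gradedRegionK KU) qDatumU 2 ∧
      ¬ CandMochizuki30.H uFull.toLatticeSituation uSetting (gradedRegionK KU) qDatumU (fun _ _ => 0) ∧
      CandMochizuki30.H uFull.toLatticeSituation uSetting (gradedRegionK KU) qDatumU (fun i _ => 3 / 4 * (((i : ℕ) + 1 : ℕ) : ℝ) ^ 2)) :=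
  ⟨⟨M01a_u, M01b_u, M01c_u, M02a_u, not_M02b_u, M45_u, not_M47a_u, not_M47b_u, CandMochizuki32SplitB1.ismIsometric_split, not_M47c_u⟩,
    ⟨M03a_u, not_M03b_u, not_M04a_u, not_M04b_u, M04c_u, M36a_u, not_M36b_u _, M36c_u, M36d_u, uSetting_not_gapH3⟩,
    ⟨placewise_u, not_M40a_u, not_M40b_u⟩,
    ⟨X07ab_u.1, X07ab_u.2, not_AO4_u, (M31_u_iff 1).2 rfl, fun h => absurd ((M31_u_iff 2).1 h) (by decide), not_M06_zero_u, M06_u_exact⟩⟩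

end Summit.ABC.IUTFork.Repair.CandMochizuki32UniformB1

end
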